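import Summits.CriticalPhenomena.SAWScalingLimit.Theses.SAWLeftRightFKG
import Summits.CriticalPhenomena.SAWScalingLimit.Theorems.SAWLeftRightFKGNotFKGAtOneWindBox
import Summits.CriticalPhenomena.SAWScalingLimit.Theorems.SAWLeftRightFKGNotFKGAtOneMeshBox
import Summits.CriticalPhenomena.SAWScalingLimit.Theorems.SAWLeftRightFKGNotFKGAtOneBoxCensus

/-!
# `NotFKGAtOne` holds: left–right positive association FAILS for the counting measure (line `three-by-three-corner-witness`)

Crux `stmt-CriticalPhenomena-11233` of route `route-CriticalPhenomena-SAWLeftRightFKG`, decl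
`Summit.CriticalPhenomena.SAWScalingLimit.Theses.SAWLeftRightFKG.NotFKGAtOne` — the route's NEGATIVE GUARD
"switches on at criticality": the left–right association statement of the route (`LeftRightFKG`) with the
critical weight `x_c^{|γ|}` replaced by the COUNTING measure (`Measure.count`, fugacity `1`) is FALSE.

**`notFKGAtOne : NotFKGAtOne`** — THE WITNESS (the refuter's, `Cruxes/NotFKGAtOne/Disproof.lean` §3, line
`three-by-three-corner-witness`, lead prover): mesh `δ = 1`; `C` = the 16-step counter-clockwise boundary walk
of the lattice square `[-1,3]²` based at `c₀ = (-1,-1)` (`exists_sq3`), so that `Ω(C) = {wind(C,·) ≠ 0}`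
contains the open square `(-1,3)²` and `Ω(C)_1 = ℤ²[{0,1,2}²]` (stubs `stub_windBox`, `stub_meshBox`, landed
in the sibling files); marked corners `a = (0,0)`, `b = (2,2)` with boundary neighbours `a' = (0,-1)`,
`b' = (2,3)` on `C`; events `A = {γ | 1 ≤ wcross 0 0 γ}` (= first step North) and
`B = {γ | 1 ≤ wcross 1 1 γ}` (= last step East), which are `≼`-UP-CLOSED in every domain because the crux's
relation `le γ₁ γ₂` (the lens loop `γ₁ · γ₂⁻¹` winds non-negatively about every point) forces
`wcross m k γ₁ ≤ wcross m k γ₂` at every face (landed `wcross_le_of_wind_nonneg`; `le_wcross_of_lrLE`);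
and among the 12 corner-to-corner chords `|A| = |B| = 6`, `|A ∩ B| = 2` (stub `stub_boxCensus`), so
`|A|·|B| = 36 > 24 = |univ|·|A ∩ B|`.  No definition is introduced: the witness walk enters as an `∃`
(`exists_sq3`, a literal 16-step walk whose support is checked by `rfl`), the crux's `let Ω` / `let le` are
the landed `FKGToTraversalBound.Negative.dom` / `lrLE`.

Honours the standing disproof (cycle 1, no kill, crux TRUE): §2 (a witness needs two non-nested up-sets and
incomparable chords — `6, 6, 2`; non-degenerate data), §4 S₁ (`|V| ≥ 8` — here 9), S₃ (nothing is claimed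
at `x_c`: this is the guard at `x = 1`).  Everything here is elementary ("folklore").
-/

noncomputable section

open scoped ENNReal
open MeasureTheory Set Literature.Probability.LatticeModels Literature.Probability.RandomPlanarGeometry
  Literature.Topology.PlaneTopology Summit.CriticalPhenomena.SAWScalingLimit.Theses.SAWLeftRightFKG
open Summit.CriticalPhenomena.SAWScalingLimit.Theorems.LeftRightFKG.Negative
open Summit.CriticalPhenomena.SAWScalingLimit.Theorems.FKGToTraversalBound.Negative (dom lrLE)

namespace Summit.CriticalPhenomena.SAWScalingLimit.Theorems.NotFKGAtOne

/-- **The witness walk, existentially**: a closed lattice walk based at `c₀ = (-1,-1)` whose support is the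
counter-clockwise boundary cycle of the square `[-1,3]²` — realised by the literal 16-step walk
`(-1,-1) → (0,-1) → ⋯ → (3,-1) → (3,0) → ⋯ → (3,3) → (2,3) → ⋯ → (-1,3) → (-1,2) → ⋯ → (-1,-1)`
(support checked by `rfl`). [folklore] -/
theorem exists_sq3 : ∃ C : (zdGraph 2).Walk c₀ c₀, C.support.tail =
      [bx 0 (-1), bx 1 (-1), bx 2 (-1), bx 3 (-1), bx 3 0, bx 3 1, bx 3 2, bx 3 3,
        bx 2 3, bx 1 3, bx 0 3, bx (-1) 3, bx (-1) 2, bx (-1) 1, bx (-1) 0, c₀] :=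
  ⟨.cons (adj_bx (-1) (-1) 0 (-1) (by decide)) <| .cons (adj_bx 0 (-1) 1 (-1) (by decide)) <|
    .cons (adj_bx 1 (-1) 2 (-1) (by decide)) <| .cons (adj_bx 2 (-1) 3 (-1) (by decide)) <|
    .cons (adj_bx 3 (-1) 3 0 (by decide)) <| .cons (adj_bx 3 0 3 1 (by decide)) <|
    .cons (adj_bx 3 1 3 2 (by decide)) <| .cons (adj_bx 3 2 3 3 (by decide)) <|
    .cons (adj_bx 3 3 2 3 (by decide)) <| .cons (adj_bx 2 3 1 3 (by decide)) <|
    .cons (adj_bx 1 3 0 3 (by decide)) <| .cons (adj_bx 0 3 (-1) 3 (by decide)) <|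
    .cons (adj_bx (-1) 3 (-1) 2 (by decide)) <| .cons (adj_bx (-1) 2 (-1) 1 (by decide)) <|
    .cons (adj_bx (-1) 1 (-1) 0 (by decide)) <| .cons (adj_bx (-1) 0 (-1) (-1) (by decide)) <| .nil,
    rfl⟩

/-- **Crossing-count superlevel events are `≼`-up-closed — in EVERY domain (`δ = 1`), unconditionally.**
The crux's relation `lrLE γ₁ γ₂` (the lens loop `γ₁ · γ₂⁻¹` winds `≥ 0` about every point) forces
`wcross m k γ₁ ≤ wcross m k γ₂` at every face `(m,k)` (landed `wcross_le_of_wind_nonneg`; the height bound it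
asks for is read off the two finite supports). [folklore] -/
theorem le_wcross_of_lrLE {Ω : Set ℂ} {a b : Site 2} (m k c : ℤ) (γ₁ γ₂ : SAW.DomainSAW Ω 1 a b)
    (h : lrLE γ₁ γ₂) (h₁ : c ≤ wcross m k γ₁.walk) : c ≤ wcross m k γ₂.walk := by
  have hG : ∀ x y, (discreteDomainGraph Ω 1).Adj x y → (zdGraph 2).Adj x y := fun x y hxy =>
    meshGraph_le_zdGraph Ω 1 (discreteDomainGraph_le_meshGraph Ω 1 hxy)
  classical
  obtain ⟨Y, hY⟩ := Finset.exists_le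
    (insert k (((γ₁.walk.support ++ γ₂.walk.support).map fun x : Site 2 => x 1).toFinset))
  have hkY : k ≤ Y := hY k (Finset.mem_insert_self _ _)
  have hs : ∀ x ∈ γ₁.walk.support ++ γ₂.walk.support, x 1 ≤ Y := fun x hx =>
    hY (x 1) (Finset.mem_insert_of_mem (List.mem_toFinset.2 (List.mem_map.2 ⟨x, hx, rfl⟩)))
  have key := wcross_le_of_wind_nonneg hG γ₁.walk γ₂.walk hkY
    (fun x hx => hs x (List.mem_append_left _ hx)) (fun x hx => hs x (List.mem_append_right _ hx))
    (h (probeL m k))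
  omega

/-- **`NotFKGAtOne` (crux stmt-CriticalPhenomena-11233 of route `SAWLeftRightFKG`): left–right positive
association in event form FAILS for the counting measure.**  Witness `(δ, c, a, b, a', b', C) =
(1, (-1,-1), (0,0), (2,2), (0,-1), (2,3), ∂[-1,3]²)` with the up-closed corner events
`{1 ≤ wcross 0 0}` and `{1 ≤ wcross 1 1}`: `6 · 6 = 36 > 24 = 12 · 2`. [folklore] -/
theorem notFKGAtOne : Summit.CriticalPhenomena.SAWScalingLimit.Theses.SAWLeftRightFKG.NotFKGAtOne := by
  unfold Summit.CriticalPhenomena.SAWScalingLimit.Theses.SAWLeftRightFKG.NotFKGAtOne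
  intro hall
  obtain ⟨C, hC⟩ := exists_sq3
  have hsupp : C.support = c₀ :: C.support.tail := C.cons_tail_support.symm
  have ha' : bx 0 (-1) ∈ C.support := by rw [hsupp, hC]; decide
  have hb' : bx 2 3 ∈ C.support := by rw [hsupp, hC]; decide
  have h1 := hall 1 c₀ (bx 0 0) (bx 2 2) (bx 0 (-1)) (bx 2 3) C
  dsimp only at h1
  obtain ⟨hR, hV⟩ := stub_windBox C hC
  obtain ⟨cA, cB, cU, cAB⟩ := stub_boxCensus (dom C 1) (stub_meshBox (dom C 1) hR hV)
  have key : Measure.count {γ : SAW.DomainSAW (dom C 1) 1 (bx 0 0) (bx 2 2) | 1 ≤ wcross 0 0 γ.walk} *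
      Measure.count {γ : SAW.DomainSAW (dom C 1) 1 (bx 0 0) (bx 2 2) | 1 ≤ wcross 1 1 γ.walk} ≤
      Measure.count (Set.univ : Set (SAW.DomainSAW (dom C 1) 1 (bx 0 0) (bx 2 2))) *
        Measure.count ({γ : SAW.DomainSAW (dom C 1) 1 (bx 0 0) (bx 2 2) | 1 ≤ wcross 0 0 γ.walk} ∩
          {γ | 1 ≤ wcross 1 1 γ.walk}) :=
    h1 one_pos ha' hb' (adj_bx 0 0 0 (-1) (by decide)) (adj_bx 2 2 2 3 (by decide)) _ _
      (fun γ₁ γ₂ h h₁ => le_wcross_of_lrLE 0 0 1 γ₁ γ₂ h h₁)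
      (fun γ₁ γ₂ h h₁ => le_wcross_of_lrLE 1 1 1 γ₁ γ₂ h h₁)
  rw [cA, cB, cU, cAB] at key
  have e1 : (6 : ℝ≥0∞) * 6 = ((36 : ℕ) : ℝ≥0∞) := by norm_num
  have e2 : (12 : ℝ≥0∞) * 2 = ((24 : ℕ) : ℝ≥0∞) := by norm_num
  rw [e1, e2] at key
  exact absurd (Nat.cast_le.1 key) (by norm_num)

end Summit.CriticalPhenomena.SAWScalingLimit.Theorems.NotFKGAtOne

end
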